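import Summits.QuantumFields.GaugeBoot.Rows.GLYZc1D3HCanon1
import Summits.QuantumFields.GaugeBoot.Rows.GLYZc1D3HCanon2
import Summits.QuantumFields.GaugeBoot.Rows.GLYZc1D3HCanon3
import Summits.QuantumFields.GaugeBoot.Rows.GLYZc1D3HCanon4
import Summits.QuantumFields.GaugeBoot.Rows.GLYZc1D3RCanon1
import Summits.QuantumFields.GaugeBoot.Rows.GLYZc1D3RCanon2
import HarnessLib

/-!
# Gauge-boot: the positivity blocks of the glyz-c1-rp-3D problems IN THE PROBLEM VARIABLES are PSD for the torus state

Cell `pub-gaugeboot` (HOME `run/shared/lean/pub/pub-gaugeboot/`), seat lean1 (binding layer for rows C3–C14).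

HONEST FRAMING (page 1 of every file of this cell): certified bounds on lattice expectations at STATED coupling,
gauge group, dimension and torus size; NOT a mass gap, NOT a continuum limit, NOT a string tension, NOT large `N`.
The venture is explicitly NOT Yang–Mills-summit-bearing (barriers `FixedCouplingUltralocality`,
`PerturbativeInvisibility`).

Assembles the kernel-checked class tables (`hcanon_table`, `scanon_table`, `lcanon_table`) and turns the raw-word block
theorems of `GLYZc1D3Blocks` into statements about the problem files' own variables `y v = ⟨W_0(label v)⟩`:
`H_entry`/`site_entry`/`link_entry` (every block entry IS the labelled variable, in expectation, on every torus) and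
`H_nonneg_label`/`site_nonneg_label`/`link_nonneg_label` (the three blocks with entries `y (N1c1D3.cls<k> i j)` —
lean3's shared class tables of the certificate replays — are positive semi-definite quadratic forms). Together with `GLYZc1D3Eqs{A,B,C}` (𝓔) this is the kernel
part of the relaxation soundness for rows C3–C14; the dual certificates stay reader-certified (A56 (2)).
-/

noncomputable section

open Literature.MathematicalPhysics.QuantumFieldTheory

namespace Summit.QuantumFields.GaugeBoot

namespace GLYZc1D3

open Matrix

/-- **Every entry of the `H` class table canonicalises.** -/
theorem hcanon_table : ∀ i j : Fin 85, HCanonOK i j := by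
  intro i; fin_cases i
  exacts [hcanon_row_0, hcanon_row_1, hcanon_row_2, hcanon_row_3, hcanon_row_4, hcanon_row_5, hcanon_row_6, hcanon_row_7, hcanon_row_8, hcanon_row_9, hcanon_row_10, hcanon_row_11, hcanon_row_12, hcanon_row_13, hcanon_row_14, hcanon_row_15, hcanon_row_16, hcanon_row_17, hcanon_row_18, hcanon_row_19, hcanon_row_20, hcanon_row_21, hcanon_row_22, hcanon_row_23, hcanon_row_24, hcanon_row_25, hcanon_row_26, hcanon_row_27, hcanon_row_28, hcanon_row_29, hcanon_row_30, hcanon_row_31, hcanon_row_32, hcanon_row_33, hcanon_row_34, hcanon_row_35, hcanon_row_36, hcanon_row_37, hcanon_row_38, hcanon_row_39, hcanon_row_40, hcanon_row_41, hcanon_row_42, hcanon_row_43, hcanon_row_44, hcanon_row_45, hcanon_row_46, hcanon_row_47, hcanon_row_48, hcanon_row_49, hcanon_row_50, hcanon_row_51, hcanon_row_52, hcanon_row_53, hcanon_row_54, hcanon_row_55, hcanon_row_56, hcanon_row_57, hcanon_row_58, hcanon_row_59, hcanon_row_60, hcanon_row_61, hcanon_row_62, hcanon_row_63, hcanon_row_64,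 hcanon_row_65, hcanon_row_66, hcanon_row_67, hcanon_row_68, hcanon_row_69, hcanon_row_70, hcanon_row_71, hcanon_row_72, hcanon_row_73, hcanon_row_74, hcanon_row_75, hcanon_row_76, hcanon_row_77, hcanon_row_78, hcanon_row_79, hcanon_row_80, hcanon_row_81, hcanon_row_82, hcanon_row_83, hcanon_row_84]

/-- **Every entry of the `site1` class table canonicalises.** -/
theorem scanon_table : ∀ i j : Fin 46, SCanonOK i j := by
  intro i; fin_cases i
  exacts [scanon_row_0, scanon_row_1, scanon_row_2, scanon_row_3, scanon_row_4, scanon_row_5, scanon_row_6, scanon_row_7, scanon_row_8, scanon_row_9, scanon_row_10, scanon_row_11, scanon_row_12, scanon_row_13, scanon_row_14, scanon_row_15, scanon_row_16, scanon_row_17, scanon_row_18, scanon_row_19, scanon_row_20, scanon_row_21, scanon_row_22, scanon_row_23, scanon_row_24, scanon_row_25, scanon_row_26, scanon_row_27, scanon_row_28, scanon_row_29, scanon_row_30, scanon_row_31, scanon_row_32, scanon_row_33, scanon_row_34, scanon_row_35, scanon_row_36, scanon_row_37, scanon_row_38, scanon_row_39, scanon_row_40, scanon_row_41, scanon_row_42,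 scanon_row_43, scanon_row_44, scanon_row_45]

/-- **Every entry of the `link1` class table canonicalises.** -/
theorem lcanon_table : ∀ i j : Fin 46, LCanonOK i j := by
  intro i; fin_cases i
  exacts [lcanon_row_0, lcanon_row_1, lcanon_row_2, lcanon_row_3, lcanon_row_4, lcanon_row_5, lcanon_row_6, lcanon_row_7, lcanon_row_8, lcanon_row_9, lcanon_row_10, lcanon_row_11, lcanon_row_12, lcanon_row_13, lcanon_row_14, lcanon_row_15, lcanon_row_16, lcanon_row_17, lcanon_row_18, lcanon_row_19, lcanon_row_20, lcanon_row_21, lcanon_row_22, lcanon_row_23, lcanon_row_24, lcanon_row_25, lcanon_row_26, lcanon_row_27, lcanon_row_28, lcanon_row_29, lcanon_row_30, lcanon_row_31, lcanon_row_32, lcanon_row_33, lcanon_row_34, lcanon_row_35, lcanon_row_36, lcanon_row_37, lcanon_row_38, lcanon_row_39, lcanon_row_40, lcanon_row_41, lcanon_row_42, lcanon_row_43, lcanon_row_44, lcanon_row_45]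

variable (β : ℝ) (L : ℕ) [NeZero L]

/-- `y v = ⟨W_0(label v)⟩_{(ℤ/L)³, SU(2), β_std}`: the problem variables evaluated on the torus state. -/
def y (v : Fin 435) : ℝ := Rung0D3.W β L (label v)

/-- **`H` entries are problem variables**: `⟨W_0(Sᵢ⁻¹·Sⱼ)⟩ = y (cls0 i j)`. -/
theorem H_entry (i j : Fin 85) : Rung0D3.W β L (Word.reverse (S i) ++ S j) = y β L (Certificates.N1c1D3.cls0 i j) := by
  obtain ⟨hd, hc⟩ := hcanon_table i j
  unfold y Rung0D3.W
  rw [← hc]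
  exact wilsonExpectation_wordLoop_canon (suRep 2) (continuous_suRep 2) _ _ _ _ _ _ hd

/-- **`site1` entries are problem variables**: `⟨W_0((θ'Rᵢ)⁻¹·Rⱼ)⟩ = y (cls1 i j)`. -/
theorem site_entry (i j : Fin 46) :
    Rung0D3.W β L (Word.reverse ((R i).map Step.reflect0) ++ R j) = y β L (Certificates.N1c1D3.cls1 i j) := by
  obtain ⟨hd, hc⟩ := scanon_table i j
  unfold y Rung0D3.W
  rw [← hc]
  exact wilsonExpectation_wordLoop_canon (suRep 2) (continuous_suRep 2) _ _ _ _ _ _ hd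

/-- **`link1` entries are problem variables**: `⟨W_0((θ'Rᵢ)⁻¹·a·Rⱼ·A)⟩ = y (cls2 i j)`. -/
theorem link_entry (i j : Fin 46) :
    Rung0D3.W β L (Word.reverse ((R i).map Step.reflect0) ++ [.fwd 0] ++ R j ++ [.bwd 0]) =
      y β L (Certificates.N1c1D3.cls2 i j) := by
  obtain ⟨hd, hc⟩ := lcanon_table i j
  unfold y Rung0D3.W
  rw [← hc]
  exact wilsonExpectation_wordLoop_canon (suRep 2) (continuous_suRep 2) _ _ _ _ _ _ hd

/-- **The `H` block in the problem variables is PSD** (every torus, every real `β_std`). -/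
theorem H_nonneg_label (c : Fin 85 → ℝ) : 0 ≤ ∑ i, ∑ j, c i * c j * y β L (Certificates.N1c1D3.cls0 i j) := by
  have h := H_nonneg β L c
  simp only [H_entry] at h
  exact h

/-- **The `site1` block in the problem variables is PSD** (every even torus, every real `β_std`). -/
theorem site_nonneg_label (hL : Even L) (c : Fin 46 → ℝ) :
    0 ≤ ∑ i, ∑ j, c i * c j * y β L (Certificates.N1c1D3.cls1 i j) := by
  have h := site_nonneg β L hL c
  simp only [site_entry] at h
  exact h

/-- **The `link1` block in the problem variables is PSD** (every even torus `L ≥ 4`, every `β_std ≥ 0`). -/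
theorem link_nonneg_label (hL : Even L) (h4 : 4 ≤ L) (hβ : 0 ≤ β) (c : Fin 46 → ℝ) :
    0 ≤ ∑ i, ∑ j, c i * c j * y β L (Certificates.N1c1D3.cls2 i j) := by
  have h := link_nonneg β L hL h4 hβ c
  simp only [link_entry] at h
  exact h

/-- The class table of `H` is symmetric. -/
theorem cls0_symm : ∀ i j : Fin 85, Certificates.N1c1D3.cls0 i j = Certificates.N1c1D3.cls0 j i := by decide +kernel

/-- The class table of `site1` is symmetric. -/
theorem cls1_symm : ∀ i j : Fin 46, Certificates.N1c1D3.cls1 i j = Certificates.N1c1D3.cls1 j i := by decide +kernel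

/-- The class table of `link1` is symmetric. -/
theorem cls2_symm : ∀ i j : Fin 46, Certificates.N1c1D3.cls2 i j = Certificates.N1c1D3.cls2 j i := by decide +kernel

/-- A real matrix whose entries are a symmetric relabelling of a PSD quadratic form is positive semidefinite. -/
theorem posSemidef_of_table {n : ℕ} (cls : Fin n → Fin n → Fin 435) (hsymm : ∀ i j, cls i j = cls j i)
    (hq : ∀ c : Fin n → ℝ, 0 ≤ ∑ i, ∑ j, c i * c j * y β L (cls i j)) (B : Matrix (Fin n) (Fin n) ℝ)
    (hB : ∀ i j, B i j = y β L (cls i j)) : B.PosSemidef := by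
  refine Matrix.PosSemidef.of_dotProduct_mulVec_nonneg ?_ fun x => ?_
  · ext i j
    simp only [Matrix.conjTranspose_apply, star_trivial, hB, hsymm i j]
  · have h := hq x
    simp only [dotProduct, Matrix.mulVec, star_trivial, hB, Finset.mul_sum] at h ⊢
    exact h.trans_eq (Finset.sum_congr rfl fun i _ => Finset.sum_congr rfl fun j _ => by ring)

/-- **lean3's block `0` (`H`) evaluated on the torus expectations is positive semidefinite** (every torus, every β). -/
theorem gramBlock0_posSemidef : (Certificates.N1c1D3.gramBlock0 (y β L)).PosSemidef :=
  posSemidef_of_table β L _ cls0_symm (H_nonneg_label β L) _ (Certificates.N1c1D3.gramBlock0_apply _)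

/-- **lean3's block `1` (`site1`) on the torus expectations is positive semidefinite** (even L, every β). -/
theorem gramBlock1_posSemidef (hL : Even L) : (Certificates.N1c1D3.gramBlock1 (y β L)).PosSemidef :=
  posSemidef_of_table β L _ cls1_symm (site_nonneg_label β L hL) _ (Certificates.N1c1D3.gramBlock1_apply _)

/-- **lean3's block `2` (`link1`) on the torus expectations is positive semidefinite** (even L ≥ 4, β ≥ 0). -/
theorem gramBlock2_posSemidef (hL : Even L) (h4 : 4 ≤ L) (hβ : 0 ≤ β) :
    (Certificates.N1c1D3.gramBlock2 (y β L)).PosSemidef :=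
  posSemidef_of_table β L _ cls2_symm (link_nonneg_label β L hL h4 hβ) _ (Certificates.N1c1D3.gramBlock2_apply _)

end GLYZc1D3

end Summit.QuantumFields.GaugeBoot

end
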